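import Mathlib
import HarnessLib
import Literature.Analysis.FluidPDE.VectorCalculus
import Summits.NavierStokesRegularity.NavierStokesRegularity.Theorems.UnthreadedRigidityDoorUnthreadedRigidityCoZonalSameDegreeTriples

/-!
# W2 door `UnthreadedRigidity` (stmt-NavierStokesRegularity-27585) — `IsotypicWindowRigidityL l n` for every degree `l ≥ 1` and every `n ≤ 3`, by name

Prover file (engine-1 g72; `--supports stmt-NavierStokesRegularity-27585 --as helper`; route-independent imports).  One packaging theorem over the
landed cases `n = 1` (`ThreadingJets.isotypicWindowRigidityL_one_harmonic`, p715559), `n = 2` (`CoZonal.isotypicWindowRigidityL_two_harmonics`,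
p718618), `n = 3` (`CoZonal.isotypicWindowRigidityL_three_harmonics`) and the degenerate `n = 0` (the empty family: every slice is the zero
field, `isoShellL_zero`): ★ `isotypicWindowRigidityL_of_le_three : 1 ≤ l → n ≤ 3 → IsotypicWindowRigidityL l n`.

HONEST LABEL: isotypic windows over ≤ 3 harmonics are SPECIAL data (restrictions of 27585); `n ≥ 4` in degrees `l ≥ 3` (W-ii) stays OPEN;
`UnthreadedRigidity` (27585), W2 and NS regularity remain OPEN; nothing here is a statement about Navier–Stokes regularity.  0 kit.
-/

noncomputable section

-- the summit and its single sub-problem share the name (CONVENTIONS §1), as in every Theorems file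
set_option linter.dupNamespace false

namespace Summit.NavierStokesRegularity.NavierStokesRegularity.Theorems.UnthreadedRigidity.CoZonal

open Filter Set
open Literature.Analysis.FluidPDE (curl)
open Summit.NavierStokesRegularity.NavierStokesRegularity.Theorems.UnthreadedRigidity.VirialHorn
open Summit.NavierStokesRegularity.NavierStokesRegularity.Theorems.UnthreadedRigidity.ProfileHorn (E3)
open Summit.NavierStokesRegularity.NavierStokesRegularity.Theorems.UnthreadedRigidity.ThreadingJets (separableWindowRigidityL
  isotypicWindowRigidityL_one_harmonic)

/-- the isotypic datum over the EMPTY family is the zero field. -/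
theorem isoShellL_zero (c : Fin 0 → ℝ → ℝ) (B : Fin 0 → E3 → ℝ) (x₀ x : E3) : isoShellL 0 c B x₀ x = 0 := by
  have h0 : (fun x : E3 => (∑ m : Fin 0, c m ‖x - x₀‖ * B m (x - x₀)) • (x - x₀)) = fun _ => (0 : E3) := by
    funext z; simp
  have hc : curl (fun _ : E3 => (0 : E3)) = fun _ => (0 : E3) := by
    funext z; ext i; fin_cases i <;> simp [curl]
  unfold isoShellL
  rw [h0, hc, hc]

/-- the zero profile and the zero harmonic give the zero shell. -/
theorem sepShellL_zero_zero (x₀ x : E3) : sepShellL (fun _ : ℝ => (0 : ℝ)) (fun _ : E3 => (0 : ℝ)) x₀ x = 0 := by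
  have h0 : (fun x : E3 => ((fun _ : ℝ => (0 : ℝ)) ‖x - x₀‖ * (fun _ : E3 => (0 : ℝ)) (x - x₀)) • (x - x₀)) = fun _ => (0 : E3) := by
    funext z; simp
  have hc : curl (fun _ : E3 => (0 : E3)) = fun _ => (0 : E3) := by
    funext z; ext i; fin_cases i <;> simp [curl]
  unfold sepShellL
  rw [h0, hc, hc]

/-- the degenerate case `n = 0`: a window of zero slices is (trivially) a separable window. -/
theorem isotypicWindowRigidityL_zero_harmonics (l : ℕ) (hl : 1 ≤ l) : IsotypicWindowRigidityL l 0 := by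
  intro S hS hconn u x₀ hcont hdiv hmild hbdd hunth hiso
  obtain ⟨B, cf, _, hslice⟩ := hiso
  refine separableWindowRigidityL hl hS hconn hcont hdiv hmild hbdd hunth fun t ht =>
    ⟨fun _ => 0, fun _ => 0, virialAdmissible_zero l, isSolidHarmonic_zero l, ?_⟩
  funext x
  rw [(hslice t ht).2, isoShellL_zero, sepShellL_zero_zero]

/-- ★ **ISOTYPIC WINDOWS OVER AT MOST THREE HARMONICS ARE RIGID, IN EVERY DEGREE**: `IsotypicWindowRigidityL l n` for all `l ≥ 1`, `n ≤ 3`. -/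
theorem isotypicWindowRigidityL_of_le_three (l n : ℕ) (hl : 1 ≤ l) (hn : n ≤ 3) : IsotypicWindowRigidityL l n := by
  interval_cases n
  · exact isotypicWindowRigidityL_zero_harmonics l hl
  · exact isotypicWindowRigidityL_one_harmonic l hl
  · exact isotypicWindowRigidityL_two_harmonics l hl
  · exact isotypicWindowRigidityL_three_harmonics l hl

end Summit.NavierStokesRegularity.NavierStokesRegularity.Theorems.UnthreadedRigidity.CoZonal

end
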